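import Summits.Ventures.CertifiedArithmetic.LowPrec.Exact

/-!
# Exact products: the full OCP instance matrix into bfloat16 and binary32

HONEST FRAMING (venture CertifiedArithmetic / cell `pub-lowprec`): certified error envelopes and
provably optimal rounding/accumulation schemes for low-precision formats under stated cost models;
every table by two implementations; no hardware or vendor claims.

Every product of two OCP element data (`E4M3`, `E5M2`, `E3M2`, `E2M3`, `E2M1`, any of the 15
unordered pairs) is the value of a `bfloat16` datum and of a `binary32` datum — instances of
`MiniFloat.exists_toRat_eq_mul` (Exact.lean; hypotheses `p_α ≥ p₁ + p₂`, quantum alignment `d`,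
range, each closed by `decide`/`decide +kernel`). The six FP8-only instances are in Exact.lean; this
file adds the remaining 24 (the gemm seat's Lemma E for accumulators bfloat16/binary32: the
product stage of every OCP mixed-precision GEMM into these accumulators is error-free).
-/

namespace Literature.ComputerArithmetic.FloatingPoint

namespace Format

open MiniFloat

/-- `E4M3 · E3M2` is exact in `bfloat16` (`d = 120`). [folklore] -/
theorem E4M3_mul_E3M2_exact_in_BFloat16 (x : MiniFloat E4M3) (y : MiniFloat E3M2) :
    ∃ z : MiniFloat BFloat16, z.toRat = x.toRat * y.toRat :=
  exists_toRat_eq_mul (by decide) (d := 120) (by decide) (by decide +kernel) x y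

/-- `E4M3 · E3M2` is exact in `binary32` (`d = 136`). [folklore] -/
theorem E4M3_mul_E3M2_exact_in_Binary32 (x : MiniFloat E4M3) (y : MiniFloat E3M2) :
    ∃ z : MiniFloat Binary32, z.toRat = x.toRat * y.toRat :=
  exists_toRat_eq_mul (by decide) (d := 136) (by decide) (by decide +kernel) x y

/-- `E4M3 · E2M3` is exact in `bfloat16` (`d = 121`). [folklore] -/
theorem E4M3_mul_E2M3_exact_in_BFloat16 (x : MiniFloat E4M3) (y : MiniFloat E2M3) :
    ∃ z : MiniFloat BFloat16, z.toRat = x.toRat * y.toRat :=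
  exists_toRat_eq_mul (by decide) (d := 121) (by decide) (by decide +kernel) x y

/-- `E4M3 · E2M3` is exact in `binary32` (`d = 137`). [folklore] -/
theorem E4M3_mul_E2M3_exact_in_Binary32 (x : MiniFloat E4M3) (y : MiniFloat E2M3) :
    ∃ z : MiniFloat Binary32, z.toRat = x.toRat * y.toRat :=
  exists_toRat_eq_mul (by decide) (d := 137) (by decide) (by decide +kernel) x y

/-- `E4M3 · E2M1` is exact in `bfloat16` (`d = 123`). [folklore] -/
theorem E4M3_mul_E2M1_exact_in_BFloat16 (x : MiniFloat E4M3) (y : MiniFloat E2M1) :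
    ∃ z : MiniFloat BFloat16, z.toRat = x.toRat * y.toRat :=
  exists_toRat_eq_mul (by decide) (d := 123) (by decide) (by decide +kernel) x y

/-- `E4M3 · E2M1` is exact in `binary32` (`d = 139`). [folklore] -/
theorem E4M3_mul_E2M1_exact_in_Binary32 (x : MiniFloat E4M3) (y : MiniFloat E2M1) :
    ∃ z : MiniFloat Binary32, z.toRat = x.toRat * y.toRat :=
  exists_toRat_eq_mul (by decide) (d := 139) (by decide) (by decide +kernel) x y

/-- `E5M2 · E3M2` is exact in `bfloat16` (`d = 113`). [folklore] -/
theorem E5M2_mul_E3M2_exact_in_BFloat16 (x : MiniFloat E5M2) (y : MiniFloat E3M2) :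
    ∃ z : MiniFloat BFloat16, z.toRat = x.toRat * y.toRat :=
  exists_toRat_eq_mul (by decide) (d := 113) (by decide) (by decide +kernel) x y

/-- `E5M2 · E3M2` is exact in `binary32` (`d = 129`). [folklore] -/
theorem E5M2_mul_E3M2_exact_in_Binary32 (x : MiniFloat E5M2) (y : MiniFloat E3M2) :
    ∃ z : MiniFloat Binary32, z.toRat = x.toRat * y.toRat :=
  exists_toRat_eq_mul (by decide) (d := 129) (by decide) (by decide +kernel) x y

/-- `E5M2 · E2M3` is exact in `bfloat16` (`d = 114`). [folklore] -/
theorem E5M2_mul_E2M3_exact_in_BFloat16 (x : MiniFloat E5M2) (y : MiniFloat E2M3) :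
    ∃ z : MiniFloat BFloat16, z.toRat = x.toRat * y.toRat :=
  exists_toRat_eq_mul (by decide) (d := 114) (by decide) (by decide +kernel) x y

/-- `E5M2 · E2M3` is exact in `binary32` (`d = 130`). [folklore] -/
theorem E5M2_mul_E2M3_exact_in_Binary32 (x : MiniFloat E5M2) (y : MiniFloat E2M3) :
    ∃ z : MiniFloat Binary32, z.toRat = x.toRat * y.toRat :=
  exists_toRat_eq_mul (by decide) (d := 130) (by decide) (by decide +kernel) x y

/-- `E5M2 · E2M1` is exact in `bfloat16` (`d = 116`). [folklore] -/
theorem E5M2_mul_E2M1_exact_in_BFloat16 (x : MiniFloat E5M2) (y : MiniFloat E2M1) :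
    ∃ z : MiniFloat BFloat16, z.toRat = x.toRat * y.toRat :=
  exists_toRat_eq_mul (by decide) (d := 116) (by decide) (by decide +kernel) x y

/-- `E5M2 · E2M1` is exact in `binary32` (`d = 132`). [folklore] -/
theorem E5M2_mul_E2M1_exact_in_Binary32 (x : MiniFloat E5M2) (y : MiniFloat E2M1) :
    ∃ z : MiniFloat Binary32, z.toRat = x.toRat * y.toRat :=
  exists_toRat_eq_mul (by decide) (d := 132) (by decide) (by decide +kernel) x y

/-- `E3M2 · E3M2` is exact in `bfloat16` (`d = 125`). [folklore] -/
theorem E3M2_mul_E3M2_exact_in_BFloat16 (x : MiniFloat E3M2) (y : MiniFloat E3M2) :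
    ∃ z : MiniFloat BFloat16, z.toRat = x.toRat * y.toRat :=
  exists_toRat_eq_mul (by decide) (d := 125) (by decide) (by decide +kernel) x y

/-- `E3M2 · E3M2` is exact in `binary32` (`d = 141`). [folklore] -/
theorem E3M2_mul_E3M2_exact_in_Binary32 (x : MiniFloat E3M2) (y : MiniFloat E3M2) :
    ∃ z : MiniFloat Binary32, z.toRat = x.toRat * y.toRat :=
  exists_toRat_eq_mul (by decide) (d := 141) (by decide) (by decide +kernel) x y

/-- `E3M2 · E2M3` is exact in `bfloat16` (`d = 126`). [folklore] -/
theorem E3M2_mul_E2M3_exact_in_BFloat16 (x : MiniFloat E3M2) (y : MiniFloat E2M3) :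
    ∃ z : MiniFloat BFloat16, z.toRat = x.toRat * y.toRat :=
  exists_toRat_eq_mul (by decide) (d := 126) (by decide) (by decide +kernel) x y

/-- `E3M2 · E2M3` is exact in `binary32` (`d = 142`). [folklore] -/
theorem E3M2_mul_E2M3_exact_in_Binary32 (x : MiniFloat E3M2) (y : MiniFloat E2M3) :
    ∃ z : MiniFloat Binary32, z.toRat = x.toRat * y.toRat :=
  exists_toRat_eq_mul (by decide) (d := 142) (by decide) (by decide +kernel) x y

/-- `E3M2 · E2M1` is exact in `bfloat16` (`d = 128`). [folklore] -/
theorem E3M2_mul_E2M1_exact_in_BFloat16 (x : MiniFloat E3M2) (y : MiniFloat E2M1) :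
    ∃ z : MiniFloat BFloat16, z.toRat = x.toRat * y.toRat :=
  exists_toRat_eq_mul (by decide) (d := 128) (by decide) (by decide +kernel) x y

/-- `E3M2 · E2M1` is exact in `binary32` (`d = 144`). [folklore] -/
theorem E3M2_mul_E2M1_exact_in_Binary32 (x : MiniFloat E3M2) (y : MiniFloat E2M1) :
    ∃ z : MiniFloat Binary32, z.toRat = x.toRat * y.toRat :=
  exists_toRat_eq_mul (by decide) (d := 144) (by decide) (by decide +kernel) x y

/-- `E2M3 · E2M3` is exact in `bfloat16` (`d = 127`). [folklore] -/
theorem E2M3_mul_E2M3_exact_in_BFloat16 (x : MiniFloat E2M3) (y : MiniFloat E2M3) :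
    ∃ z : MiniFloat BFloat16, z.toRat = x.toRat * y.toRat :=
  exists_toRat_eq_mul (by decide) (d := 127) (by decide) (by decide +kernel) x y

/-- `E2M3 · E2M3` is exact in `binary32` (`d = 143`). [folklore] -/
theorem E2M3_mul_E2M3_exact_in_Binary32 (x : MiniFloat E2M3) (y : MiniFloat E2M3) :
    ∃ z : MiniFloat Binary32, z.toRat = x.toRat * y.toRat :=
  exists_toRat_eq_mul (by decide) (d := 143) (by decide) (by decide +kernel) x y

/-- `E2M3 · E2M1` is exact in `bfloat16` (`d = 129`). [folklore] -/
theorem E2M3_mul_E2M1_exact_in_BFloat16 (x : MiniFloat E2M3) (y : MiniFloat E2M1) :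
    ∃ z : MiniFloat BFloat16, z.toRat = x.toRat * y.toRat :=
  exists_toRat_eq_mul (by decide) (d := 129) (by decide) (by decide +kernel) x y

/-- `E2M3 · E2M1` is exact in `binary32` (`d = 145`). [folklore] -/
theorem E2M3_mul_E2M1_exact_in_Binary32 (x : MiniFloat E2M3) (y : MiniFloat E2M1) :
    ∃ z : MiniFloat Binary32, z.toRat = x.toRat * y.toRat :=
  exists_toRat_eq_mul (by decide) (d := 145) (by decide) (by decide +kernel) x y

/-- `E2M1 · E2M1` is exact in `bfloat16` (`d = 131`). [folklore] -/
theorem E2M1_mul_E2M1_exact_in_BFloat16 (x : MiniFloat E2M1) (y : MiniFloat E2M1) :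
    ∃ z : MiniFloat BFloat16, z.toRat = x.toRat * y.toRat :=
  exists_toRat_eq_mul (by decide) (d := 131) (by decide) (by decide +kernel) x y

/-- `E2M1 · E2M1` is exact in `binary32` (`d = 147`). [folklore] -/
theorem E2M1_mul_E2M1_exact_in_Binary32 (x : MiniFloat E2M1) (y : MiniFloat E2M1) :
    ∃ z : MiniFloat Binary32, z.toRat = x.toRat * y.toRat :=
  exists_toRat_eq_mul (by decide) (d := 147) (by decide) (by decide +kernel) x y

end Format

end Literature.ComputerArithmetic.FloatingPoint
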